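import Summits.CriticalPhenomena.Ising3D.TaylorKernelPDDeltaS
import Summits.CriticalPhenomena.Ising3D.TaylorRegionDeltaLitBase
import Mathlib.Tactic.Linarith
import Mathlib.Tactic.Positivity
import Mathlib.Tactic.Ring
import HarnessLib

/-!
# δ-rows and literal-table containment with the SIGNED second-order slot (S twins of `TaylorRegionDeltaRows` / `TaylorRegionDeltaLitBase`)
(cell `pub-ising3x`, seat boot-1 gen 16; T2′ (a) of lead RULING R24-γ: the S-named copies of the literal checks on the `tabOK → validΔ_of_lit` path)

HONEST FRAMING: lottery ticket; floor = tightest certified 3D Ising CFT bounds; no exact-solution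
claim without a proof. Island framing: certified exclusion region at stated derivative order and
assumptions; not a determination of the 3D Ising critical exponents beyond that.

Verbatim copies of `deltaTfull / deltaQfull / deltaSizeOK / pmem2_deltaQfull / qSum_eq_delta_rows` (TaylorRegionDeltaRows) and
`tabOK / pmem3_tripL` (TaylorRegionDeltaLitBase) with the substitution `deltaT2 ↦ deltaT2S`, `deltaT2R δ ↦ deltaT2SR δ`,
`pmem2_deltaT2 ↦ pmem2_deltaT2S`, `evenKernel_eq_eval2_delta ↦ evenKernel_eq_eval2_deltaS` (TaylorKernelPDDeltaS). Orders 0 and 1 are unchanged; the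
row CONTRACTS downstream (`ValidΔ`) are unchanged — only the literal tables a file set may carry in slot 2 become the tighter signed ones. [folklore]
-/

namespace Summit.CriticalPhenomena.Ising3D

open Finset
open Literature.Analysis.ValidatedNumerics Literature.Analysis.ValidatedNumerics.PolyMP
open Literature.Analysis.ValidatedNumerics.NumericsMP (MI)
open Literature.MathematicalPhysics.QuantumFieldTheory.ConformalBootstrap3D

/-! ### The q-sum over a box as a triple of rows, signed slot -/

/-- The full interval table `T₀ + [−W,W]·T₁ + [0,W²]·T₂ˢ` (only its SIZE is used by the kernel). [folklore] -/
def deltaTfullS (S : ℕ) (cQ : ℕ × ℕ → ℚ) (σQ : ℚ) (s₀ W ccQ : ℚ) (l : List (ℕ × ℕ)) : IPoly2 :=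
  add2I (deltaT0 S cQ σQ s₀ ccQ l)
    (add2I (smul2MI S (enclQ S (-W) W) (deltaT1 S cQ σQ s₀ ccQ l))
      (smul2MI S (enclQ S 0 (W ^ 2)) (deltaT2S S cQ σQ s₀ W ccQ l)))

/-- Its real shadow at a given `δ`. [folklore] -/
noncomputable def deltaQfullS (cQ : ℕ × ℕ → ℚ) (σQ : ℚ) (s₀ ccQ : ℚ) (l : List (ℕ × ℕ)) (δ : ℝ) : List (List ℝ) :=
  add2 (deltaT0R cQ σQ s₀ ccQ l)
    (add2 (smul2 δ (deltaT1R cQ σQ s₀ ccQ l)) (smul2 (δ ^ 2) (deltaT2SR cQ σQ s₀ ccQ l δ)))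

/-- Size side condition of the signed δ-tables. [folklore] -/
def deltaSizeOKS (S : ℕ) (cQ : ℕ × ℕ → ℚ) (σQ : ℚ) (s₀ W ccQ : ℚ) (l : List (ℕ × ℕ)) (N : ℕ) : Bool :=
  decide (size2I (deltaTfullS S cQ σQ s₀ W ccQ l) ≤ N)

/-- [folklore] -/
theorem pmem2_deltaQfullS {S : ℕ} (hS : 0 < S) (cQ : ℕ × ℕ → ℚ) (σQ : ℚ) (s₀ : ℚ) {W : ℚ} (hW : 0 ≤ W) (ccQ : ℚ)
    (l : List (ℕ × ℕ)) {δ : ℝ} (hδ : |δ| ≤ W) :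
    PMem2 S (deltaQfullS cQ σQ s₀ ccQ l δ) (deltaTfullS S cQ σQ s₀ W ccQ l) := by
  have hδI : MI.mem S δ (enclQ S (-W) W) :=
    mem_enclQ S (by push_cast; linarith [neg_abs_le δ, hδ, (abs_le.mp hδ).1]) (by linarith [le_abs_self δ])
  have hδ2 : MI.mem S (δ ^ 2) (enclQ S 0 (W ^ 2)) := by
    refine mem_enclQ S (by push_cast; positivity) ?_
    have : δ ^ 2 ≤ (W : ℝ) ^ 2 := by
      rw [← sq_abs]; exact pow_le_pow_left₀ (abs_nonneg δ) hδ 2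
    exact_mod_cast this
  exact pmem2_add2I (pmem2_deltaT0 hS cQ σQ s₀ ccQ l)
    (pmem2_add2I (pmem2_smul2MI hS hδI (pmem2_deltaT1 hS cQ σQ s₀ ccQ l))
      (pmem2_smul2MI hS hδ2 (pmem2_deltaT2S hS cQ σQ s₀ hW ccQ l hδ)))

/-- **The q-sum over the box as a triple of rows (signed slot)**: for `s = s₀ + δ`, `|δ| ≤ W`, duplicate-free `l` and `deltaSizeOKS`,
`q̂(E, j; s) = R₀(E − cc) + δ·R₁(E − cc) + δ²·R₂ˢ(δ)(E − cc)`, `R₂ˢ = qRowOfTable (deltaT2SR … δ) N j`. [folklore] -/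
theorem qSum_eq_delta_rowsS {S : ℕ} (hS : 0 < S) (cQ : ℕ × ℕ → ℚ) (σQ : ℚ) (s₀ : ℚ) {W : ℚ} (hW : 0 ≤ W) (ccQ : ℚ)
    {l : List (ℕ × ℕ)} (hl : l.Nodup) {N : ℕ} (hN : deltaSizeOKS S cQ σQ s₀ W ccQ l N = true) {δ : ℝ} (hδ : |δ| ≤ W)
    (E : ℝ) (j : ℕ) :
    qSum (fun ab => (cQ ab : ℝ)) l.toFinset ((s₀ : ℝ) + δ) (σQ : ℝ) E j =
      evalR (qRowOfTable (deltaT0R cQ σQ s₀ ccQ l) N j) (E - ccQ) +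
        δ * evalR (qRowOfTable (deltaT1R cQ σQ s₀ ccQ l) N j) (E - ccQ) +
          δ ^ 2 * evalR (qRowOfTable (deltaT2SR cQ σQ s₀ ccQ l δ) N j) (E - ccQ) := by
  have hsize : size2 (deltaQfullS cQ σQ s₀ ccQ l δ) ≤ N := by
    rw [size2_eq_of_pmem2 (pmem2_deltaQfullS hS cQ σQ s₀ hW ccQ l hδ)]
    exact of_decide_eq_true hN
  have hQ : ∀ u v : ℝ, eval2 (deltaQfullS cQ σQ s₀ ccQ l δ) (u + v - ccQ) (u - v) =
      evenKernel (fun ab => (cQ ab : ℝ)) l.toFinset ((s₀ : ℝ) + δ) (σQ : ℝ) u v := fun u v => by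
    rw [evenKernel_eq_eval2_deltaS cQ σQ s₀ ccQ hl δ u v, deltaQfullS, eval2_add2, eval2_add2, eval2_smul2, eval2_smul2]
    ring
  rw [qSum_eq_evalR_qRowOfTable_of_eval2 _ _ _ _ _ _ hQ hsize E j, deltaQfullS, evalR_qRowOfTable_add2,
    evalR_qRowOfTable_add2, evalR_qRowOfTable_smul2, evalR_qRowOfTable_smul2]
  ring

/-! ### Literal δ-tables: containment against the signed computed tables -/

/-- Containment of the computed δ-table of order `m` (`0, 1, ≥ 2 ↦ 2`) in the literal — slot 2 against the SIGNED table `deltaT2S`. [folklore] -/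
def tabOKS (S : ℕ) (c : ℕ × ℕ → ℚ) (σQ s₀ W cc : ℚ) (l : List (ℕ × ℕ)) (T : ITab3) : ℕ → Bool
  | 0 => subset2I (deltaT0 S c σQ s₀ cc l) T.1
  | 1 => subset2I (deltaT1 S c σQ s₀ cc l) T.2.1
  | _ => subset2I (deltaT2S S c σQ s₀ W cc l) T.2.2

/-- [folklore] -/
theorem pmem3_tripLS {S : ℕ} (hS : 0 < S) (c : ℕ × ℕ → ℚ) (σQ s₀ : ℚ) {W : ℚ} (hW : 0 ≤ W) (cc : ℚ) (l : List (ℕ × ℕ))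
    {T : ITab3} (hT : ∀ m : ℕ, m < 3 → tabOKS S c σQ s₀ W cc l T m = true) (N j : ℕ) {δ : ℝ} (hδ : |δ| ≤ W) :
    PMem3 S (qRowOfTable (deltaT0R c σQ s₀ cc l) N j, qRowOfTable (deltaT1R c σQ s₀ cc l) N j,
        qRowOfTable (deltaT2SR c σQ s₀ cc l δ) N j) (tripL T N j) := by
  have h0 : subset2I (deltaT0 S c σQ s₀ cc l) T.1 = true := hT 0 (by norm_num)
  have h1 : subset2I (deltaT1 S c σQ s₀ cc l) T.2.1 = true := hT 1 (by norm_num)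
  have h2 : subset2I (deltaT2S S c σQ s₀ W cc l) T.2.2 = true := hT 2 (by norm_num)
  exact ⟨pmem_qRowOfTableI (pmem2_of_subset2I (pmem2_deltaT0 hS c σQ s₀ cc l) h0) N j,
    pmem_qRowOfTableI (pmem2_of_subset2I (pmem2_deltaT1 hS c σQ s₀ cc l) h1) N j,
    pmem_qRowOfTableI (pmem2_of_subset2I (pmem2_deltaT2S hS c σQ s₀ hW cc l hδ) h2) N j⟩

end Summit.CriticalPhenomena.Ising3D
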